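import Summits.ValiantsHypothesis.ValiantsHypothesis.Theorems.SymPencilPerFourOneRowProductCases

/-!
# Route `SymPencil` — leaf R1N of the `(11, 5, 4)` cascade, §6.5: a PRODUCT kernel plane is impossible (`--supports`
# stmt-ValiantsHypothesis-5674 `SdcSuperquadratic`; memo `SING-FIVE-CLASSIFICATION.md` §6.5; branch lemma for the residual
# of `stub_threeRowsFourCols` of `Cruxes/SdcSuperquadratic/Lines/sing_five_classification.lean`)

* `product_absurd` — normalised position (zero row `0`, rank-`3` row `1`, ✓ `perpPlanes`' PRODUCT disjunct for
  `W ⊓ ker (rowL 1)` with `(j, c) = (0, 1)`): from `Sing3 W`, no zero column, `¬ InCross W` and the per-direction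
  STAR-or-BIPARTITE tests for the row pairs `(1,2)`, `(1,3)` ⇒ `False`.  Builds the two pure generators from the
  membership description, reads (E)/(F) (`reading_E/F`, `relations_of_T3`) and dispatches to `case_a` / `case_b2` /
  `case_b3` (+ mirror) / `case_b1`.  A general column pair `(j, c)` reduces to `(0, 1)` by a column permutation of `W`
  (all hypotheses are `biPermL`-invariant) — that transport is left to the wiring step.
Honest framing: [folklore] linear algebra for the PRODUCT branch of ONE leaf (R1N) of ONE of four open size-27 cells; leaf
R1N and the cell file remain OPEN; `27 ≤ sdc(per₄) ≤ 29` unchanged; the crux `SdcSuperquadratic` and `VP ≠ VNP` untouched;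
no summit statement is proved here.  No definitions, no named facts.
-/

noncomputable section

set_option linter.dupNamespace false

namespace Summit.ValiantsHypothesis.ValiantsHypothesis.Theorems.SymPencilPerFourOneRowProduct

open Matrix Module MvPolynomial
open Literature.Computability.AlgebraicComplexity
open Summit.ValiantsHypothesis.ValiantsHypothesis.Theorems.SymPencilSingSixClassification
open Summit.ValiantsHypothesis.ValiantsHypothesis.Theorems.SymPencilPerFourOneRowKernelPlane
open Summit.ValiantsHypothesis.ValiantsHypothesis.Theorems.SymPencilPerFourPermIsotropicPlanes

variable {K : Type*} [Field K]

/-! ## 8. Assembly: a PRODUCT kernel plane (normalised to the columns `0, 1`) is impossible -/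

/-- Perm-orthogonality of two vectors with coordinate `0` zeroed, from the three relations off `0`. [folklore] -/
theorem permOrth_zero0 {a b : Fin 4 → K} (h12 : a 1 * b 2 + a 2 * b 1 = 0) (h13 : a 1 * b 3 + a 3 * b 1 = 0)
    (h23 : a 2 * b 3 + a 3 * b 2 = 0) :
    PermOrth (fun m => if m = 0 then 0 else a m) (fun m => if m = 0 then 0 else b m) := by
  intro p q hpq
  fin_cases p <;> fin_cases q
  all_goals (first | exact absurd rfl hpq | skip)
  all_goals simp [pairPerm]
  · exact h12
  · exact h13
  · linear_combination h12
  · exact h23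
  · linear_combination h13
  · linear_combination h23

/-- Perm-orthogonality of two vectors with coordinate `1` zeroed, from the three relations off `1`. [folklore] -/
theorem permOrth_zero1 {a b : Fin 4 → K} (h02 : a 0 * b 2 + a 2 * b 0 = 0) (h03 : a 0 * b 3 + a 3 * b 0 = 0)
    (h23 : a 2 * b 3 + a 3 * b 2 = 0) :
    PermOrth (fun m => if m = 1 then 0 else a m) (fun m => if m = 1 then 0 else b m) := by
  intro p q hpq
  fin_cases p <;> fin_cases q
  all_goals (first | exact absurd rfl hpq | skip)
  all_goals simp [pairPerm]
  · exact h02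
  · exact h03
  · linear_combination h02
  · exact h23
  · linear_combination h03
  · linear_combination h23

/-- **PRODUCT kernel plane ⇒ contradiction** (memo §6.5, normalised position: zero row `0`, rank-`3` row `1`, kernel
plane `K₁ = K(0;0;a;0) ⊕ K(0;0;0;ā)` with `a = (α, β, 0, 0)`, `ā = (α, −β, 0, 0)`, i.e. ✓ `perpPlanes`' PRODUCT disjunct
with `(j, c) = (0, 1)`).  Inputs beyond `Sing3`: no zero column, `¬ InCross`, and the per-direction STAR-or-BIPARTITE
tests for the row pairs `(1,2)`, `(1,3)` (the workfile's tool (T1), verbatim the conclusion of ✓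
`star_or_bipartite_of_sum_sq_swap_rows01`).  Dispatch: `αβ = 0` → `case_a`; else `u₂ ≡ 0` / `u₃ ≡ 0` → `case_b2`;
`U(u) ≡ 0` / `Ū(u) ≡ 0` → `case_b3` (and its mirror); otherwise `case_b1`. [folklore] -/
theorem product_absurd [CharZero K] {W : Submodule K (Fin 4 × Fin 4 → K)} (hS : Sing3 W)
    (hi : ∀ y ∈ W, row y 0 = 0) (hcol : ∀ m : Fin 4, ∃ y ∈ W, ∃ x : Fin 4, y (x, m) ≠ 0) (hX : ¬ InCross W)
    (hnr : finrank K (W.map (rowL 1)) = 3)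
    (hT12 : ∀ y ∈ W,
      (((row y 1) 0 * (row y 2) 1 + (row y 1) 1 * (row y 2) 0 = 0 ∧ (row y 1) 0 * (row y 2) 2 + (row y 1) 2 * (row y 2) 0 = 0 ∧ (row y 1) 0 * (row y 2) 3 + (row y 1) 3 * (row y 2) 0 = 0) ∨
        ((row y 1) 0 * (row y 2) 1 + (row y 1) 1 * (row y 2) 0 = 0 ∧ (row y 1) 1 * (row y 2) 2 + (row y 1) 2 * (row y 2) 1 = 0 ∧ (row y 1) 1 * (row y 2) 3 + (row y 1) 3 * (row y 2) 1 = 0) ∨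
        ((row y 1) 0 * (row y 2) 2 + (row y 1) 2 * (row y 2) 0 = 0 ∧ (row y 1) 1 * (row y 2) 2 + (row y 1) 2 * (row y 2) 1 = 0 ∧ (row y 1) 2 * (row y 2) 3 + (row y 1) 3 * (row y 2) 2 = 0) ∨
        ((row y 1) 0 * (row y 2) 3 + (row y 1) 3 * (row y 2) 0 = 0 ∧ (row y 1) 1 * (row y 2) 3 + (row y 1) 3 * (row y 2) 1 = 0 ∧ (row y 1) 2 * (row y 2) 3 + (row y 1) 3 * (row y 2) 2 = 0)) ∨
      (((row y 1) 0 * (row y 2) 1 + (row y 1) 1 * (row y 2) 0 = 0 ∧ (row y 1) 2 * (row y 2) 3 + (row y 1) 3 * (row y 2) 2 = 0 ∧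
          ((row y 1) 0 * (row y 2) 2 + (row y 1) 2 * (row y 2) 0) * ((row y 1) 1 * (row y 2) 3 + (row y 1) 3 * (row y 2) 1) =
            ((row y 1) 0 * (row y 2) 3 + (row y 1) 3 * (row y 2) 0) * ((row y 1) 1 * (row y 2) 2 + (row y 1) 2 * (row y 2) 1)) ∨
        ((row y 1) 0 * (row y 2) 2 + (row y 1) 2 * (row y 2) 0 = 0 ∧ (row y 1) 1 * (row y 2) 3 + (row y 1) 3 * (row y 2) 1 = 0 ∧
          ((row y 1) 0 * (row y 2) 1 + (row y 1) 1 * (row y 2) 0) * ((row y 1) 2 * (row y 2) 3 + (row y 1) 3 * (row y 2) 2) =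
            ((row y 1) 0 * (row y 2) 3 + (row y 1) 3 * (row y 2) 0) * ((row y 1) 1 * (row y 2) 2 + (row y 1) 2 * (row y 2) 1)) ∨
        ((row y 1) 0 * (row y 2) 3 + (row y 1) 3 * (row y 2) 0 = 0 ∧ (row y 1) 1 * (row y 2) 2 + (row y 1) 2 * (row y 2) 1 = 0 ∧
          ((row y 1) 0 * (row y 2) 1 + (row y 1) 1 * (row y 2) 0) * ((row y 1) 2 * (row y 2) 3 + (row y 1) 3 * (row y 2) 2) =
            ((row y 1) 0 * (row y 2) 2 + (row y 1) 2 * (row y 2) 0) * ((row y 1) 1 * (row y 2) 3 + (row y 1) 3 * (row y 2) 1))))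
    (hT13 : ∀ y ∈ W,
      (((row y 1) 0 * (row y 3) 1 + (row y 1) 1 * (row y 3) 0 = 0 ∧ (row y 1) 0 * (row y 3) 2 + (row y 1) 2 * (row y 3) 0 = 0 ∧ (row y 1) 0 * (row y 3) 3 + (row y 1) 3 * (row y 3) 0 = 0) ∨
        ((row y 1) 0 * (row y 3) 1 + (row y 1) 1 * (row y 3) 0 = 0 ∧ (row y 1) 1 * (row y 3) 2 + (row y 1) 2 * (row y 3) 1 = 0 ∧ (row y 1) 1 * (row y 3) 3 + (row y 1) 3 * (row y 3) 1 = 0) ∨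
        ((row y 1) 0 * (row y 3) 2 + (row y 1) 2 * (row y 3) 0 = 0 ∧ (row y 1) 1 * (row y 3) 2 + (row y 1) 2 * (row y 3) 1 = 0 ∧ (row y 1) 2 * (row y 3) 3 + (row y 1) 3 * (row y 3) 2 = 0) ∨
        ((row y 1) 0 * (row y 3) 3 + (row y 1) 3 * (row y 3) 0 = 0 ∧ (row y 1) 1 * (row y 3) 3 + (row y 1) 3 * (row y 3) 1 = 0 ∧ (row y 1) 2 * (row y 3) 3 + (row y 1) 3 * (row y 3) 2 = 0)) ∨
      (((row y 1) 0 * (row y 3) 1 + (row y 1) 1 * (row y 3) 0 = 0 ∧ (row y 1) 2 * (row y 3) 3 + (row y 1) 3 * (row y 3) 2 = 0 ∧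
          ((row y 1) 0 * (row y 3) 2 + (row y 1) 2 * (row y 3) 0) * ((row y 1) 1 * (row y 3) 3 + (row y 1) 3 * (row y 3) 1) =
            ((row y 1) 0 * (row y 3) 3 + (row y 1) 3 * (row y 3) 0) * ((row y 1) 1 * (row y 3) 2 + (row y 1) 2 * (row y 3) 1)) ∨
        ((row y 1) 0 * (row y 3) 2 + (row y 1) 2 * (row y 3) 0 = 0 ∧ (row y 1) 1 * (row y 3) 3 + (row y 1) 3 * (row y 3) 1 = 0 ∧
          ((row y 1) 0 * (row y 3) 1 + (row y 1) 1 * (row y 3) 0) * ((row y 1) 2 * (row y 3) 3 + (row y 1) 3 * (row y 3) 2) =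
            ((row y 1) 0 * (row y 3) 3 + (row y 1) 3 * (row y 3) 0) * ((row y 1) 1 * (row y 3) 2 + (row y 1) 2 * (row y 3) 1)) ∨
        ((row y 1) 0 * (row y 3) 3 + (row y 1) 3 * (row y 3) 0 = 0 ∧ (row y 1) 1 * (row y 3) 2 + (row y 1) 2 * (row y 3) 1 = 0 ∧
          ((row y 1) 0 * (row y 3) 1 + (row y 1) 1 * (row y 3) 0) * ((row y 1) 2 * (row y 3) 3 + (row y 1) 3 * (row y 3) 2) =
            ((row y 1) 0 * (row y 3) 2 + (row y 1) 2 * (row y 3) 0) * ((row y 1) 1 * (row y 3) 3 + (row y 1) 3 * (row y 3) 1))))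
    {α β : K} (hαβ : α ≠ 0 ∨ β ≠ 0)
    (hprod : ∀ d, d ∈ W ⊓ LinearMap.ker (rowL 1) ↔ ((∀ x, x ≠ 2 → x ≠ 3 → row d x = 0) ∧
      (∃ μ : K, row d 2 = μ • lvec 0 1 α β) ∧ (∃ ν : K, row d 3 = ν • lvec 0 1 α (-β)))) : False := by
  classical
  -- the two pure generators
  let k₁ : Fin 4 × Fin 4 → K := fun p => if p.1 = 2 then lvec 0 1 α β p.2 else 0
  let k₂ : Fin 4 × Fin 4 → K := fun p => if p.1 = 3 then lvec 0 1 α (-β) p.2 else 0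
  have hk₁ : k₁ ∈ W := (Submodule.mem_inf.1 ((hprod k₁).2 ⟨fun x h2 _ => by funext m; simp [k₁, SymPencilSingSixClassification.row, h2],
    ⟨1, by funext m; simp [k₁, SymPencilSingSixClassification.row]⟩,
    ⟨0, by funext m; simp [k₁, SymPencilSingSixClassification.row]⟩⟩)).1
  have hk₂ : k₂ ∈ W := (Submodule.mem_inf.1 ((hprod k₂).2 ⟨fun x _ h3 => by funext m; simp [k₂, SymPencilSingSixClassification.row, h3],
    ⟨0, by funext m; simp [k₂, SymPencilSingSixClassification.row]⟩,
    ⟨1, by funext m; simp [k₂, SymPencilSingSixClassification.row]⟩⟩)).1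
  have hk₁1 : row k₁ 1 = 0 := by funext m; simp [k₁, SymPencilSingSixClassification.row]
  have hk₁3 : row k₁ 3 = 0 := by funext m; simp [k₁, SymPencilSingSixClassification.row]
  have hk₁2 : row k₁ 2 = ![α, β, 0, 0] := by
    funext m; fin_cases m <;> simp [k₁, SymPencilSingSixClassification.row, lvec, Pi.single_apply]
  have hk₂1 : row k₂ 1 = 0 := by funext m; simp [k₂, SymPencilSingSixClassification.row]
  have hk₂2 : row k₂ 2 = 0 := by funext m; simp [k₂, SymPencilSingSixClassification.row]
  have hk₂3 : row k₂ 3 = ![α, -β, 0, 0] := by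
    funext m; fin_cases m <;> simp [k₂, SymPencilSingSixClassification.row, lvec, Pi.single_apply]
  -- the relations (E) and (F)
  have hE : ∀ y ∈ W, y (3, 2) * (β * y (1, 0) + α * y (1, 1)) + y (1, 2) * (β * y (3, 0) + α * y (3, 1)) = 0 ∧
      y (3, 3) * (β * y (1, 0) + α * y (1, 1)) + y (1, 3) * (β * y (3, 0) + α * y (3, 1)) = 0 ∧
      y (1, 2) * y (3, 3) + y (1, 3) * y (3, 2) = 0 := by
    intro y hy
    have h := relations_of_T3 hαβ (u := row y 1) (a := row k₁ 2) (w := row y 3)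
      (by rw [hk₁2]; rfl) (by rw [hk₁2]; rfl) (by rw [hk₁2]; rfl) (by rw [hk₁2]; rfl)
      (fun l => reading_E hS hk₁ hk₁1 hk₁3 hy l)
    exact h
  have hαβ' : α ≠ 0 ∨ -β ≠ 0 := hαβ.imp id (fun h => neg_ne_zero.2 h)
  have hF : ∀ y ∈ W, y (2, 2) * (-β * y (1, 0) + α * y (1, 1)) + y (1, 2) * (-β * y (2, 0) + α * y (2, 1)) = 0 ∧
      y (2, 3) * (-β * y (1, 0) + α * y (1, 1)) + y (1, 3) * (-β * y (2, 0) + α * y (2, 1)) = 0 ∧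
      y (1, 2) * y (2, 3) + y (1, 3) * y (2, 2) = 0 := by
    intro y hy
    have h := relations_of_T3 hαβ' (u := row y 1) (a := row k₂ 3) (w := row y 2)
      (by rw [hk₂3]; rfl) (by rw [hk₂3]; rfl) (by rw [hk₂3]; rfl) (by rw [hk₂3]; rfl)
      (fun l => by rw [T3_swap₂₃]; exact reading_F hS hk₂ hk₂1 hk₂2 hy l)
    exact h
  -- dispatch
  by_cases hβ0 : β = 0
  · have hα : α ≠ 0 := hαβ.resolve_right (fun h => h hβ0)
    subst hβ0
    refine case_a 0 hi hcol hX hnr (fun y hy => ?_) (fun y hy => ?_)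
    · obtain ⟨e1, e2, e3⟩ := hE y hy
      refine permOrth_zero0 ?_ ?_ e3
      · have : α * (y (1, 1) * y (3, 2) + y (1, 2) * y (3, 1)) = 0 := by linear_combination e1
        exact (mul_eq_zero.1 this).resolve_left hα
      · have : α * (y (1, 1) * y (3, 3) + y (1, 3) * y (3, 1)) = 0 := by linear_combination e2
        exact (mul_eq_zero.1 this).resolve_left hα
    · obtain ⟨e1, e2, e3⟩ := hF y hy
      refine permOrth_zero0 ?_ ?_ e3
      · have : α * (y (1, 1) * y (2, 2) + y (1, 2) * y (2, 1)) = 0 := by linear_combination e1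
        exact (mul_eq_zero.1 this).resolve_left hα
      · have : α * (y (1, 1) * y (2, 3) + y (1, 3) * y (2, 1)) = 0 := by linear_combination e2
        exact (mul_eq_zero.1 this).resolve_left hα
  by_cases hα0 : α = 0
  · have hβ : β ≠ 0 := hαβ.resolve_left (fun h => h hα0)
    subst hα0
    refine case_a 1 hi hcol hX hnr (fun y hy => ?_) (fun y hy => ?_)
    · obtain ⟨e1, e2, e3⟩ := hE y hy
      refine permOrth_zero1 ?_ ?_ e3
      · have : β * (y (1, 0) * y (3, 2) + y (1, 2) * y (3, 0)) = 0 := by linear_combination e1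
        exact (mul_eq_zero.1 this).resolve_left hβ
      · have : β * (y (1, 0) * y (3, 3) + y (1, 3) * y (3, 0)) = 0 := by linear_combination e2
        exact (mul_eq_zero.1 this).resolve_left hβ
    · obtain ⟨e1, e2, e3⟩ := hF y hy
      refine permOrth_zero1 ?_ ?_ e3
      · have : β * (y (1, 0) * y (2, 2) + y (1, 2) * y (2, 0)) = 0 := by linear_combination -e1
        exact (mul_eq_zero.1 this).resolve_left hβ
      · have : β * (y (1, 0) * y (2, 3) + y (1, 3) * y (2, 0)) = 0 := by linear_combination -e2
        exact (mul_eq_zero.1 this).resolve_left hβ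
  -- `αβ ≠ 0`
  by_cases hu2 : ∀ y ∈ W, y (1, 2) = 0
  · exact case_b2 hα0 hi hcol hnr 2 (Or.inl rfl) (fun y hy => (hE y hy).1) (fun y hy => (hF y hy).1) hu2
  by_cases hu3 : ∀ y ∈ W, y (1, 3) = 0
  · exact case_b2 hα0 hi hcol hnr 3 (Or.inr rfl) (fun y hy => (hE y hy).2.1) (fun y hy => (hF y hy).2.1) hu3
  push Not at hu2 hu3
  by_cases hU : ∀ y ∈ W, β * y (1, 0) + α * y (1, 1) = 0
  · exact case_b3 hα0 hβ0 3 hnr hE ⟨k₂, hk₂, hk₂1, hk₂3⟩ hU hu2 hT13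
  by_cases hŪ : ∀ y ∈ W, -β * y (1, 0) + α * y (1, 1) = 0
  · exact case_b3 (β := -β) hα0 (neg_ne_zero.2 hβ0) 2 hnr hF ⟨k₁, hk₁, hk₁1, by rw [neg_neg]; exact hk₁2⟩ hŪ hu2 hT12
  push Not at hU hŪ
  exact case_b1 hα0 hF ⟨k₁, hk₁, hk₁1, hk₁2⟩ hu2 hu3 hU hŪ hT12

end Summit.ValiantsHypothesis.ValiantsHypothesis.Theorems.SymPencilPerFourOneRowProduct

end
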